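import Summits.MatrixMultiplication.MatrixMultiplication.Theorems.SaturationLadderUniformWindow
import Literature.NumberTheory.Sieve.JurkatRichertMajorants
import HarnessLib

/-!
# Saturation ladder — Kernel XXV-B: the level-1 window with a gap and the first uniform rung below `log 4`

Cell `decomp-mm`, lens `decomp-mm-lens-1` (grading / quantitative ladder), gen 53; supports the
deciding crux `SubexpSaturation` (item 25909) of `route-MatrixMultiplication-SaturationLadder`.
No new hypotheses, no `sorry`.  Uses Kernel XXV-A `SaturationLadderUniformWindow` (windows, the
explicit twin clause) and Kernel XXIV/XXIV-A (`U(log 4)`, the corners and chords).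

* §3 THE LEVEL-1 WINDOW WITH A GAP.  The corner-and-chord profile of Kernel XXIV is STRICTLY below
  `log 4` by a definite amount: `(3+9x)·e^{1/20} ≤ 4·4^x` for `x ≥ 0` (`three_add_nine_mul_le_gap`;
  tangents of the convex `4^x` at `3/8` and `1/2`), so every chord of grade `k ≥ 1` has length
  `≤ e^{log 4/(1−t) − 1/20}` (`chord_len_le_gap`) and the level-1 profile certifies
  `r ≤ e^{C/(1−t)}` on any window `[0,T)`, `T ≤ 1`, with `C ≥ max(1.1, log 4 − (1−T)/20)`
  (`window_levelOne`; the first segment `[0,1/2]` already at any `C ≥ 1.1`, `firstSegment`).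
* §4 THE RUNGS.  `U(log 4 − (1−t₀)/20)` from ANY clause at a rate `c ∈ [1.1, log 4 − (1−t₀)/20]`
  with explicit onset `t₀` (`uniformClause_of_onset`); for the twin family with `Y`-threshold
  `j₀ ≥ 64`: **`U(log 4 − (47j₀+37)/(20(j₀+1)(30j₀+37)))`** (`uniformClause_of_familyY` — the
  PRICE LIST: lowering the threshold of `familyY` to `j₀` buys exactly this rung); unconditionally
  (`j₀ = 1000`) **`U(log 4 − 1/12800)`**, i.e. `Δ(r) ≤ log 4 − 1/12800` for every `r ≥ 1`
  (`uniformClause_log_four_sub`, `frontierDefect_le_log_four_sub`,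
  `exists_uniformClause_lt_log_four`) — the first rung of the uniform ladder strictly below the
  level-1 value `log 4` of Kernel XXIV.

Where the theorems stop, and the price of the next rung.  Level-1 windows give at most
`log 4 − (1−t₀)/20 = log 4 − O(1/j₀)`; a rung `U(C₁)` with `C₁` visibly below `log 4` (in-class
prediction `C₁ ≈ 1.1`) needs sub-`4^{1/(1−t)}` certificates on the MID-RANGE window
`t ∈ [2/3, T⋆)`, i.e. a twin table `j ≈ 4 … 1000` (individual exact twin points,
`decide`-certified as in `SaturationLadderTwinExactInstances`, plus the `Y`-inequality on a range
`[j₁, 1000)`), after which Kernel XXV-A §1 and §4 here assemble the rung mechanically.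

[novel: the gap form of the chord bound, the window-with-gap and the price list are this lineage's;
convexity of the tight region is Lotti–Romani 1983, the corners are Kernel XXIV-A, the twin family is
Coppersmith–Winograd 1990 §8.]
-/


set_option linter.dupNamespace false

namespace Summit.MatrixMultiplication.MatrixMultiplication.Theorems.SaturationLadderUniformWindowRung

open Literature.Computability.AlgebraicComplexity
open Summit.MatrixMultiplication.MatrixMultiplication.Theses.SaturationLadder
open Summit.MatrixMultiplication.MatrixMultiplication.Theorems.SaturationLadderTowerLimit
open Summit.MatrixMultiplication.MatrixMultiplication.Theorems.SaturationLadderExpSaturation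
open Summit.MatrixMultiplication.MatrixMultiplication.Theorems.SaturationLadderChordLadder
open Summit.MatrixMultiplication.MatrixMultiplication.Theorems.SaturationLadderFrontierDefect
open Summit.MatrixMultiplication.MatrixMultiplication.Theorems.SaturationLadderUniformCorners
open Summit.MatrixMultiplication.MatrixMultiplication.Theorems.SaturationLadderUniformDefect
open Summit.MatrixMultiplication.MatrixMultiplication.Theorems.SaturationLadderTwinFamily
open Summit.MatrixMultiplication.MatrixMultiplication.Theorems.SaturationLadderTwinSaturation
open Summit.MatrixMultiplication.MatrixMultiplication.Theorems.SaturationLadderUniformWindow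

noncomputable section

/-! ## §3 The level-1 window with a gap -/

/-- `e^{1/20} ≤ 20/19` (`e^{−1/20} ≥ 19/20`). [folklore] -/
theorem exp_one_div_twenty_le : Real.exp (1 / 20) ≤ 20 / 19 := by
  have h := Real.add_one_le_exp (-(1 / 20 : ℝ))
  have hpos := Real.exp_pos (1 / 20 : ℝ)
  have e : Real.exp (1 / 20) * Real.exp (-(1 / 20 : ℝ)) = 1 := by
    rw [← Real.exp_add]; norm_num
  nlinarith [mul_le_mul_of_nonneg_left h hpos.le]

/-- `2^{3/4} = e^{(3/8) log 4} ≥ 1.6817` (`1.6817⁴ < 8`). [folklore] -/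
theorem exp_three_eighths_log_four_ge : (1.6817 : ℝ) ≤ Real.exp (3 / 8 * Real.log 4) := by
  have e4 : Real.log 4 = 2 * Real.log 2 := by
    rw [show (4 : ℝ) = 2 ^ 2 by norm_num, Real.log_pow]; norm_num
  have eA : Real.exp (3 / 8 * Real.log 4) ^ 4 = 8 := by
    rw [← Real.exp_nat_mul, e4,
      show ((4 : ℕ) : ℝ) * (3 / 8 * (2 * Real.log 2)) = ((3 : ℕ) : ℝ) * Real.log 2 by push_cast; ring,
      Real.exp_nat_mul, Real.exp_log two_pos]
    norm_num
  by_contra h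
  push Not at h
  have h4 : Real.exp (3 / 8 * Real.log 4) ^ 4 ≤ (1.6817 : ℝ) ^ 4 :=
    pow_le_pow_left₀ (Real.exp_pos _).le h.le 4
  rw [eA] at h4
  norm_num at h4

/-- **The gap inequality**: `(3 + 9x)·e^{1/20} ≤ 4·e^{x log 4}` for `x ≥ 0` (tangents of the convex
`4^x` at `x = 3/8` and `x = 1/2`; the true minimum of `4·4^x/(3+9x)` on `[0,1]` is `e^{0.0536…}` at
`x ≈ 0.39`). [folklore] -/
theorem three_add_nine_mul_le_gap {x : ℝ} (hx0 : 0 ≤ x) :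
    (3 + 9 * x) * Real.exp (1 / 20) ≤ 4 * Real.exp (x * Real.log 4) := by
  have hL1 := log_four_gt
  have hL2 := log_four_lt
  have hE := exp_one_div_twenty_le
  have hA := exp_three_eighths_log_four_ge
  have e4 : Real.log 4 = 2 * Real.log 2 := by
    rw [show (4 : ℝ) = 2 ^ 2 by norm_num, Real.log_pow]; norm_num
  refine le_trans (mul_le_mul_of_nonneg_left hE (by linarith)) ?_
  rcases le_or_gt x (11 / 25) with h | h
  · -- tangent at `3/8`
    have eAx : Real.exp (x * Real.log 4) =
        Real.exp (3 / 8 * Real.log 4) * Real.exp ((x - 3 / 8) * Real.log 4) := by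
      rw [← Real.exp_add]; ring_nf
    have ht := Real.add_one_le_exp ((x - 3 / 8) * Real.log 4)
    rw [eAx]
    rcases le_or_gt x (3 / 8) with h2 | h2
    · have hm : (x - 3 / 8) * 1.3863 ≤ (x - 3 / 8) * Real.log 4 :=
        mul_le_mul_of_nonpos_left hL2.le (by linarith)
      have h1y : 0 ≤ (x - 3 / 8) * Real.log 4 + 1 := by linarith
      have step := mul_le_mul hA ht h1y (Real.exp_pos _).le
      linarith
    · have hm : (x - 3 / 8) * 1.3862 ≤ (x - 3 / 8) * Real.log 4 :=
        mul_le_mul_of_nonneg_left hL1.le (by linarith)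
      have h1y : 0 ≤ (x - 3 / 8) * Real.log 4 + 1 := by linarith
      have step := mul_le_mul hA ht h1y (Real.exp_pos _).le
      linarith
  · -- tangent at `1/2`
    have e2 : Real.exp (x * Real.log 4) = 2 * Real.exp ((x - 1 / 2) * Real.log 4) := by
      rw [show x * Real.log 4 = Real.log 2 + (x - 1 / 2) * Real.log 4 by rw [e4]; ring, Real.exp_add,
        Real.exp_log two_pos]
    have ht := Real.add_one_le_exp ((x - 1 / 2) * Real.log 4)
    rw [e2]
    rcases le_or_gt (1 / 2) x with h2 | h2
    · have hm : (x - 1 / 2) * 1.3862 ≤ (x - 1 / 2) * Real.log 4 :=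
        mul_le_mul_of_nonneg_left hL1.le (by linarith)
      linarith
    · have hm : (x - 1 / 2) * 1.3863 ≤ (x - 1 / 2) * Real.log 4 :=
        mul_le_mul_of_nonpos_left hL2.le (by linarith)
      linarith

/-- **The chord bound with a gap.**  Along the chord between the level-1 corners `k` and `k+1`
(parameter `s ∈ [0,1]`) the length is `≤ e^{log 4/(1−t) − 1/20}` (Kernel XXIV-A `chord_len_le` had
`e^{log 4/(1−t)}`): with `x = (k+1)s/(k+2)` the length is `≤ 4^k(3+9x) ≤ 4^{k+1+x}·e^{−1/20}` and
`k+1+x ≤ 1/(1−t)`. [cite: LottiRomani1983, §1 (p. 173)] -/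
theorem chord_len_le_gap (k : ℕ) {s : ℝ} (hs0 : 0 ≤ s) (hs1 : s ≤ 1) :
    (1 - s) * (3 * (4 : ℝ) ^ k * k / ((k : ℝ) + 1)) +
        s * (3 * (4 : ℝ) ^ (k + 1) * ((k : ℝ) + 1) / ((k : ℝ) + 1 + 1)) ≤
      Real.exp (Real.log 4 /
        (1 - ((1 - s) * ((k : ℝ) / ((k : ℝ) + 1)) + s * (((k : ℝ) + 1) / ((k : ℝ) + 1 + 1)))) -
          1 / 20) := by
  set K : ℝ := (k : ℝ) with hKdef
  have hK0 : (0 : ℝ) ≤ K := Nat.cast_nonneg _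
  have h4k : (0 : ℝ) < (4 : ℝ) ^ k := by positivity
  have hL0 : 0 < Real.log 4 := Real.log_pos (by norm_num)
  set x : ℝ := (K + 1) * s / (K + 1 + 1) with hxdef
  have hx0 : 0 ≤ x := by positivity
  have hxs : x ≤ s := by
    rw [hxdef, div_le_iff₀ (by positivity)]
    nlinarith
  have hfrac : 3 * (4 : ℝ) ^ k * K / (K + 1) ≤ 3 * (4 : ℝ) ^ k := by
    rw [div_le_iff₀ (by positivity)]
    nlinarith
  have hlen : (1 - s) * (3 * (4 : ℝ) ^ k * K / (K + 1)) +
      s * (3 * (4 : ℝ) ^ (k + 1) * (K + 1) / (K + 1 + 1)) ≤ (4 : ℝ) ^ k * (3 + 9 * x) := by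
    have h1 : (1 - s) * (3 * (4 : ℝ) ^ k * K / (K + 1)) ≤ (1 - s) * (3 * (4 : ℝ) ^ k) :=
      mul_le_mul_of_nonneg_left hfrac (by linarith)
    have h2 : s * (3 * (4 : ℝ) ^ (k + 1) * (K + 1) / (K + 1 + 1)) = (4 : ℝ) ^ k * (12 * x) := by
      rw [hxdef, pow_succ]
      field_simp
      ring
    rw [h2]
    nlinarith [mul_nonneg (sub_nonneg.2 hxs) h4k.le]
  have h1t : 1 - ((1 - s) * (K / (K + 1)) + s * ((K + 1) / (K + 1 + 1))) =
      (K + 2 - s) / ((K + 1) * (K + 2)) := by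
    field_simp
    ring
  have hden : 0 < K + 2 - s := by linarith
  have hkey : K + 1 + x ≤ (K + 1) * (K + 2) / (K + 2 - s) := by
    rw [le_div_iff₀ hden, hxdef, show K + 1 + 1 = K + 2 by ring]
    have e : (K + 1 + (K + 1) * s / (K + 2)) * (K + 2 - s) =
        (K + 1) * ((K + 2) ^ 2 - s ^ 2) / (K + 2) := by
      field_simp
      ring
    rw [e, div_le_iff₀ (by positivity)]
    nlinarith [sq_nonneg s, hK0]
  have hexp_arg : (K + 1 + x) * Real.log 4 ≤
      Real.log 4 / (1 - ((1 - s) * (K / (K + 1)) + s * ((K + 1) / (K + 1 + 1)))) := by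
    rw [h1t, div_div_eq_mul_div, mul_div_assoc, mul_comm]
    exact mul_le_mul_of_nonneg_left hkey hL0.le
  have hA := three_add_nine_mul_le_gap hx0
  have hA' : 3 + 9 * x ≤ 4 * Real.exp (x * Real.log 4) * Real.exp (-(1 / 20)) := by
    have hpos := Real.exp_pos (-(1 / 20 : ℝ))
    have e : Real.exp (1 / 20) * Real.exp (-(1 / 20 : ℝ)) = 1 := by
      rw [← Real.exp_add]; norm_num
    have := mul_le_mul_of_nonneg_right hA hpos.le
    calc 3 + 9 * x = (3 + 9 * x) * (Real.exp (1 / 20) * Real.exp (-(1 / 20 : ℝ))) := by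
          rw [e, mul_one]
      _ = (3 + 9 * x) * Real.exp (1 / 20) * Real.exp (-(1 / 20 : ℝ)) := by ring
      _ ≤ 4 * Real.exp (x * Real.log 4) * Real.exp (-(1 / 20)) := this
  have hpow : (4 : ℝ) ^ k * 4 = Real.exp ((K + 1) * Real.log 4) := by
    have ek : ((k : ℝ) + 1) = ((k + 1 : ℕ) : ℝ) := by push_cast; ring
    rw [hKdef, ek, Real.exp_nat_mul, Real.exp_log (by norm_num : (0 : ℝ) < 4), pow_succ]
  calc (1 - s) * (3 * (4 : ℝ) ^ k * K / (K + 1)) + s * (3 * (4 : ℝ) ^ (k + 1) * (K + 1) / (K + 1 + 1))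
      ≤ (4 : ℝ) ^ k * (3 + 9 * x) := hlen
    _ ≤ (4 : ℝ) ^ k * (4 * Real.exp (x * Real.log 4) * Real.exp (-(1 / 20))) :=
        mul_le_mul_of_nonneg_left hA' h4k.le
    _ = Real.exp ((K + 1) * Real.log 4) * Real.exp (x * Real.log 4) * Real.exp (-(1 / 20)) := by
        rw [← hpow]; ring
    _ = Real.exp ((K + 1 + x) * Real.log 4 - 1 / 20) := by
        rw [← Real.exp_add, ← Real.exp_add]; ring_nf
    _ ≤ _ := Real.exp_le_exp.2 (by linarith [hexp_arg])

/-- **First segment**: every `t ∈ [0, 1/2]` is tight at `r = 1 + 7t ≤ e^{1.1/(1−t)}` (the chord from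
`(0,1)` to `(1/2, 9/2)`). [cite: LottiRomani1983, §1 (p. 173)] -/
theorem firstSegment : ∀ t : ℝ, 0 ≤ t → t ≤ 1 / 2 →
    ∃ r : ℝ, 1 ≤ r ∧ r ≤ Real.exp (1.1 / (1 - t)) ∧ omegaRect ℂ 1 t r ≤ 1 + r := by
  intro t ht0 ht
  have h1t : 0 < 1 - t := by linarith
  have h01 : omegaRect ℂ 1 0 1 ≤ 1 + 1 := by rw [omegaRect_one_zero_one ℂ]; norm_num
  have hc := tight_convexComb (t₁ := 0) (r₁ := 1) (t₂ := 1 / 2) (r₂ := 9 / 2) (a := 1 - 2 * t)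
    (b := 2 * t) le_rfl zero_le_one (by norm_num) (by norm_num) (by linarith) (by linarith) (by ring)
    h01 tight_half_nineHalves
  have e1 : (1 - 2 * t) * 0 + 2 * t * (1 / 2) = t := by ring
  have e2 : (1 - 2 * t) * 1 + 2 * t * (9 / 2) = 1 + 7 * t := by ring
  rw [e1, e2] at hc
  refine ⟨1 + 7 * t, by linarith, ?_, hc⟩
  have key : ∀ u : ℝ, 0 ≤ u → u ≤ 1.1 / (1 - t) →
      1 + u + u ^ 2 / 2 + u ^ 3 / 6 ≤ Real.exp (1.1 / (1 - t)) :=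
    fun u hu0 hu =>
      (Literature.NumberTheory.Sieve.JurkatRichert.cubic_le_exp hu0).trans (Real.exp_le_exp.2 hu)
  rcases le_or_gt t (1 / 4) with h₁ | h₁
  · have hu : (1.1 : ℝ) ≤ 1.1 / (1 - t) := by
      rw [le_div_iff₀ h1t]; nlinarith
    have := key 1.1 (by norm_num) hu
    norm_num at this
    linarith
  rcases le_or_gt t (2 / 5) with h₂ | h₂
  · have hu : (1.46 : ℝ) ≤ 1.1 / (1 - t) := by
      rw [le_div_iff₀ h1t]; nlinarith
    have := key 1.46 (by norm_num) hu
    norm_num at this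
    linarith
  · have hu : (1.83 : ℝ) ≤ 1.1 / (1 - t) := by
      rw [le_div_iff₀ h1t]; nlinarith
    have := key 1.83 (by norm_num) hu
    norm_num at this
    linarith

/-- **The level-1 window with a gap.**  For `T ≤ 1` and `C ≥ max(1.1, log 4 − (1−T)/20)`, every
`t ∈ [0, T)` is tight at some `r ∈ [1, e^{C/(1−t)}]`: the first segment on `[0,1/2]`, and for
`t > 1/2` the chord of grade `k = ⌊t/(1−t)⌋` between the corners of Kernel XXIV-A, of length
`≤ e^{log 4/(1−t) − 1/20} ≤ e^{C/(1−t)}` because `1 − t > 1 − T`. [cite: LottiRomani1983, §1 (p. 173)] -/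
theorem window_levelOne {C T : ℝ} (hT : T ≤ 1) (hC : Real.log 4 - (1 - T) / 20 ≤ C)
    (hC' : 1.1 ≤ C) :
    ∀ t : ℝ, 0 ≤ t → t < T →
      ∃ r : ℝ, 1 ≤ r ∧ r ≤ Real.exp (C / (1 - t)) ∧ omegaRect ℂ 1 t r ≤ 1 + r := by
  intro t ht0 htT
  have ht1 : t < 1 := lt_of_lt_of_le htT hT
  have h1t : 0 < 1 - t := by linarith
  rcases le_or_gt t (1 / 2) with h | h
  · obtain ⟨r, h1, h2, h3⟩ := firstSegment t ht0 h
    exact ⟨r, h1, h2.trans (Real.exp_le_exp.2 (div_le_div_of_nonneg_right hC' h1t.le)), h3⟩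
  · -- the grade `k = ⌊t/(1−t)⌋ ≥ 1` and the chord between the corners `k`, `k+1`
    set y : ℝ := t / (1 - t) with hydef
    have hy0 : 0 ≤ y := div_nonneg ht0 h1t.le
    have hy1 : 1 ≤ y := by rw [hydef, le_div_iff₀ h1t]; linarith
    set k : ℕ := ⌊y⌋₊ with hkdef
    have hk : 1 ≤ k := Nat.le_floor (by exact_mod_cast hy1)
    have hky : (k : ℝ) ≤ y := Nat.floor_le hy0
    have hyk : y < (k : ℝ) + 1 := Nat.lt_floor_add_one y
    set K : ℝ := (k : ℝ) with hKdef
    have hK1 : (1 : ℝ) ≤ K := by rw [hKdef]; exact_mod_cast hk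
    have htk : K / (K + 1) ≤ t := by
      rw [div_le_iff₀ (by positivity)]
      have : K * (1 - t) ≤ t := by rwa [hydef, le_div_iff₀ h1t] at hky
      linarith
    have htk1 : t < (K + 1) / (K + 1 + 1) := by
      rw [lt_div_iff₀ (by positivity)]
      have : t < (K + 1) * (1 - t) := by rwa [hydef, div_lt_iff₀ h1t] at hyk
      linarith
    set s : ℝ := (t - K / (K + 1)) * ((K + 1) * (K + 2)) with hsdef
    have hs0 : 0 ≤ s := mul_nonneg (by linarith) (by positivity)
    have hs1 : s ≤ 1 := by
      rw [hsdef]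
      have h' : t * (K + 1 + 1) < K + 1 := (lt_div_iff₀ (by positivity)).1 htk1
      have e : (t - K / (K + 1)) * ((K + 1) * (K + 2)) = t * (K + 1) * (K + 2) - K * (K + 2) := by
        field_simp
      rw [e]
      nlinarith
    have hts : (1 - s) * (K / (K + 1)) + s * ((K + 1) / (K + 1 + 1)) = t := by
      rw [hsdef]
      field_simp
      ring
    obtain ⟨r₁, h1r₁, hr₁R, hT₁⟩ := corner k hk
    obtain ⟨r₂, h1r₂, hr₂R, hT₂⟩ := corner (k + 1) (by omega)
    push_cast at hr₂R hT₂
    have hc := tight_convexComb (a := 1 - s) (b := s) (by positivity) (by linarith) (by positivity)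
      (by linarith) (by linarith) hs0 (by ring) hT₁ hT₂
    rw [hts] at hc
    have h1r : 1 ≤ (1 - s) * r₁ + s * r₂ := by
      nlinarith [mul_nonneg (sub_nonneg.2 hs1) (sub_nonneg.2 h1r₁), mul_nonneg hs0 (sub_nonneg.2 h1r₂)]
    refine ⟨(1 - s) * r₁ + s * r₂, h1r, ?_, hc⟩
    have hbound := chord_len_le_gap k hs0 hs1
    rw [hts] at hbound
    have hgap : Real.log 4 / (1 - t) - 1 / 20 ≤ C / (1 - t) := by
      have e : Real.log 4 / (1 - t) - 1 / 20 = (Real.log 4 - (1 - t) / 20) / (1 - t) := by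
        field_simp
      rw [e]
      exact div_le_div_of_nonneg_right (by linarith) h1t.le
    calc (1 - s) * r₁ + s * r₂
        ≤ (1 - s) * (3 * (4 : ℝ) ^ k * K / (K + 1)) +
            s * (3 * (4 : ℝ) ^ (k + 1) * (K + 1) / (K + 1 + 1)) :=
          add_le_add (mul_le_mul_of_nonneg_left hr₁R (by linarith)) (mul_le_mul_of_nonneg_left hr₂R hs0)
      _ ≤ Real.exp (Real.log 4 / (1 - t) - 1 / 20) := hbound
      _ ≤ Real.exp (C / (1 - t)) := Real.exp_le_exp.2 hgap

/-! ## §4 The rungs below `log 4` -/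

/-- **Onset ⟹ rung.**  A clause at rate `c ∈ [1.1, log 4 − (1−t₀)/20]` with explicit onset
`t₀ ∈ [0,1]` gives `U(log 4 − (1−t₀)/20)` (§1 + §3). [folklore] -/
theorem uniformClause_of_onset {c t₀ : ℝ} (ht₀1 : t₀ ≤ 1) (hc1 : 1.1 ≤ c)
    (hc2 : c ≤ Real.log 4 - (1 - t₀) / 20)
    (hev : ∀ t : ℝ, t₀ ≤ t → t < 1 → ∃ r : ℝ, 1 ≤ r ∧ r ≤ Real.exp (c / (1 - t)) ∧
      omegaRect ℂ 1 t r ≤ 1 + r) :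
    ∀ t : ℝ, 0 ≤ t → t < 1 → ∃ r : ℝ, 1 ≤ r ∧
      r ≤ Real.exp ((Real.log 4 - (1 - t₀) / 20) / (1 - t)) ∧ omegaRect ℂ 1 t r ≤ 1 + r :=
  uniformClause_of_window hc2 hev (window_levelOne ht₀1 le_rfl (hc1.trans hc2))

/-- **THE PRICE LIST of the twin family.**  If the `Y`-entropy inequality of the stage-2 family holds
from `j₀ ≥ 64`, then `U(log 4 − (1 − t_{j₀})/20)`, `1 − t_{j₀} = (47j₀+37)/((j₀+1)(30j₀+37))`:
lowering the threshold of `familyY` to `j₀` buys exactly this uniform rung.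
[cite: CoppersmithWinograd1990, §8] [cite: AlmanDuanVassilevskaWilliamsXuXuZhou2025, §3.4] -/
theorem uniformClause_of_familyY (j₀ : ℕ) (hj₀ : 64 ≤ j₀)
    (hY : ∀ j : ℕ, j₀ ≤ j →
      shannonEntropy
          ![((fN₁ j : ℝ) + fN₄ j + (0 : ℕ)) / (fN₁ j + fN₂ j + fN₃ j + fN₄ j + 0 + fN₆ j : ℕ),
          ((fN₂ j : ℝ) + fN₃ j) / (fN₁ j + fN₂ j + fN₃ j + fN₄ j + 0 + fN₆ j : ℕ),
          (fN₆ j : ℝ) / (fN₁ j + fN₂ j + fN₃ j + fN₄ j + 0 + fN₆ j : ℕ)] ≤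
        shannonEntropy
          ![((fN₃ j : ℝ) + (0 : ℕ) + fN₆ j) / (fN₁ j + fN₂ j + fN₃ j + fN₄ j + 0 + fN₆ j : ℕ),
          ((fN₁ j : ℝ) + fN₂ j) / (fN₁ j + fN₂ j + fN₃ j + fN₄ j + 0 + fN₆ j : ℕ),
          (fN₄ j : ℝ) / (fN₁ j + fN₂ j + fN₃ j + fN₄ j + 0 + fN₆ j : ℕ)]) :
    ∀ t : ℝ, 0 ≤ t → t < 1 → ∃ r : ℝ, 1 ≤ r ∧
      r ≤ Real.exp ((Real.log 4 - (1 - fT j₀) / 20) / (1 - t)) ∧ omegaRect ℂ 1 t r ≤ 1 + r := by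
  have hT0 : 0 ≤ fT j₀ := by rw [fT_eq]; positivity
  have hL := log_four_gt
  exact uniformClause_of_onset (fT_lt_one j₀).le le_rfl (by linarith)
    (twinClause_eleven_tenths j₀ hj₀ hY)

/-- **THE FIRST UNIFORM RUNG BELOW `log 4`: `U(log 4 − 1/12800)`.**  For every `t ∈ [0,1)` some
`r ∈ [1, e^{(log 4 − 1/12800)/(1−t)}]` has `ω(1,t,r) ≤ 1 + r` (Kernel XXIV: `U(log 4)`): the twin
family beyond `T⋆ = t_{1000}` (§2) and the level-1 window with its gap `(1−T⋆)/20 ≥ 1/12800` below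
it (§3). [cite: CoppersmithWinograd1990, §8] [cite: LottiRomani1983, §1 (p. 173)] -/
theorem uniformClause_log_four_sub :
    ∀ t : ℝ, 0 ≤ t → t < 1 → ∃ r : ℝ, 1 ≤ r ∧
      r ≤ Real.exp ((Real.log 4 - 1 / 12800) / (1 - t)) ∧ omegaRect ℂ 1 t r ≤ 1 + r := by
  have h := uniformClause_of_familyY 1000 (by norm_num) (fun j hj => familyY j hj)
  refine uniformClause_mono ?_ h
  have hw : (1 : ℝ) / 12800 ≤ (1 - fT 1000) / 20 := by
    rw [one_sub_fT_thousand]; norm_num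
  linarith

/-- **Some uniform rung strictly below the level-1 value holds.** [folklore] -/
theorem exists_uniformClause_lt_log_four :
    ∃ C : ℝ, C < Real.log 4 ∧ ∀ t : ℝ, 0 ≤ t → t < 1 → ∃ r : ℝ, 1 ≤ r ∧
      r ≤ Real.exp (C / (1 - t)) ∧ omegaRect ℂ 1 t r ≤ 1 + r :=
  ⟨Real.log 4 - 1 / 12800, by norm_num, uniformClause_log_four_sub⟩

/-- **Uniform defect bound below `log 4`**: `Δ(r) ≤ log 4 − 1/12800` for every `r ≥ 1`; equivalently
`τ_ℂ(r) ≥ 1 − (log 4 − 1/12800)/log r`. [folklore] -/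
theorem frontierDefect_le_log_four_sub {r : ℝ} (hr : 1 ≤ r) :
    (1 - sSup {t : ℝ | omegaRect ℂ 1 t r ≤ 1 + r}) * Real.log r ≤ Real.log 4 - 1 / 12800 :=
  (uniformClause_iff_defect (by linarith [log_four_gt])).1 uniformClause_log_four_sub r hr

end

end Summit.MatrixMultiplication.MatrixMultiplication.Theorems.SaturationLadderUniformWindowRung
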